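import Mathlib
import Summits.ValiantsHypothesis.ValiantsHypothesis.Theses.BarrierLever
import Summits.ValiantsHypothesis.ValiantsHypothesis.Theorems.BarrierLeverPrincipalMinorLayoutsCapacityBound

/-!
# Route BarrierLever — item `PrincipalMinorLayoutsNonsingular` (stmt-ValiantsHypothesis-19126):
# REFUTATION — TNS is false

Refutation file (`--workitem stmt-ValiantsHypothesis-19126`; cell valiant-natproofs, rung V4, 𝒟-side;
prover seat val-np-p3 gen 4). Definition-free.

**Theorem (`not_PrincipalMinorLayoutsNonsingular`).**
`¬ Theses.BarrierLever.PrincipalMinorLayoutsNonsingular`: it is NOT the case that every square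
principal-minor layout matrix `(det K[u_i ⊔ w̄_j])_{i,j}` is nonsingular for some
`K ∈ ℂ^{(h+h)×(h+h)}`. WITNESS: `h = 31`, `r = 32`, rows `u = (∅, {0}, {1}, …, {30})` (pairwise
distinct, `cex_rows_injective`), columns `w =` the `32` subsets of the block `{0,…,4} ⊆ Fin 31`
(binary digits of `j < 32`, pairwise distinct, `cex_cols_injective`). By the capacity bound of the
companion file (`TNSRefutation.tns_det_eq_zero_of_singleton_rows`) the `32 × 32` layout matrix has
rank `≤ 1 + 5² = 26` for EVERY `K`, so no `K` makes it nonsingular. (Numerically the rank is `22`;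
the smaller instance `h = 15`, `r = 16`, block `{0,…,3}` is also dead — rank `14` — but needs the
finer count `k² − k + 2`, not formalised.)

MECHANISM / SCOPE. The principal minor `det K[{a} ⊔ w̄]` sees the coordinate `a` only through the
`O(|T|)` entries `K_{aa}, K_{a,T̄}, K_{T̄,a}` and is affine-bilinear in them, so `2^{|T|}` columns
inside a block `T` beat the `1 + |T|²`-dimensional row capacity as soon as `|T| ≥ 5` and
`h + 1 ≥ 2^{|T|}` singleton rows are available. The same count with rows of size `≤ |T|/10`
(capacity `Σ_{l ≤ m} C(|T|,l)² < 2^{|T|}`) kills the universal witness `det(1 + diag(x,y)·K)` on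
layouts of size `2^{h/110}` — the middle band — so TNS admits no «large-r» repair.
CONSEQUENCES through arrows already in the tree (filed separately): TT
(`TransversalMinorLayoutsNonsingular`, via 19153), CT (`TransversalResultantKernelNonsingular`, via
19180) and every conjecture proved to imply TT (priority-peeling 19761 via 19766, parabolic 19689
via 19690, …) are false as stated; the symmetric Cauchy kernel conjecture SCK of this seat
(p489988) dies already at `h = 7` (`u = (∅, singletons)`, `w = 2^{{0,1,2}}`: capacity `2·3+1 = 7 < 8`).

WHAT THIS IS NOT: item 19717 `PartitionMinorsHitByVP` is UNTOUCHED — its witness may depend on the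
layout, and the dead layouts here have `r ≤ h + 1 ≤ (h+h)^1` (tree `partitionMinor_hit_of_card_le`);
what dies is the UNIVERSAL-witness route «TNS ⇒ 19717» (item 19133's arrow stays valid but
vacuous). Nothing on crux stmt-14610 or `VP` vs `VNP`.
-/

set_option linter.dupNamespace false

open Matrix Finset

namespace Summit.ValiantsHypothesis.ValiantsHypothesis.Theorems.BarrierLever.TNSRefutation

/-! ## The counterexample: `h = 31`, `r = 32`, rows `∅, {0}, …, {30}`, columns all subsets of `{0,…,4}` -/

/-- The rows of the counterexample (`u 0 = ∅`, `u (i+1) = {i}`) are empty or singletons. -/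
theorem cex_rows_spec (i : Fin 32) :
    (fun i : Fin 32 => if (i : ℕ) = 0 then (∅ : Finset (Fin 31))
      else ({⟨(i : ℕ) - 1, by omega⟩} : Finset (Fin 31))) i = ∅ ∨
    ∃ a : Fin 31, (fun i : Fin 32 => if (i : ℕ) = 0 then (∅ : Finset (Fin 31))
      else ({⟨(i : ℕ) - 1, by omega⟩} : Finset (Fin 31))) i = {a} := by
  by_cases h0 : (i : ℕ) = 0
  · left; simp [h0]
  · right; exact ⟨⟨(i : ℕ) - 1, by omega⟩, by simp [h0]⟩

/-- The rows of the counterexample are pairwise distinct. -/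
theorem cex_rows_injective : Function.Injective
    (fun i : Fin 32 => if (i : ℕ) = 0 then (∅ : Finset (Fin 31))
      else ({⟨(i : ℕ) - 1, by omega⟩} : Finset (Fin 31))) := by
  intro i i' hii'
  dsimp only at hii'
  by_cases h0 : (i : ℕ) = 0 <;> by_cases h0' : (i' : ℕ) = 0
  · exact Fin.ext (by omega)
  · rw [if_pos h0, if_neg h0'] at hii'
    exact absurd hii'.symm (Finset.singleton_ne_empty _)
  · rw [if_neg h0, if_pos h0'] at hii'
    exact absurd hii' (Finset.singleton_ne_empty _)
  · rw [if_neg h0, if_neg h0'] at hii'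
    have h1 := congrArg Fin.val (Finset.singleton_injective hii')
    simp only at h1
    exact Fin.ext (by omega)

/-- The columns of the counterexample (`w j` = the subset of `{0,…,4} ⊆ Fin 31` given by the binary
digits of `j < 32`) lie inside the block `{0,…,4}`. -/
theorem cex_cols_subset (j : Fin 32) :
    (fun j : Fin 32 => ((Finset.univ : Finset (Fin 5)).filter
      (fun c : Fin 5 => Nat.testBit (j : ℕ) c.val)).map (Fin.castLEEmb (by norm_num : 5 ≤ 31))) j ⊆ (Finset.univ : Finset (Fin 5)).map (Fin.castLEEmb (by norm_num : 5 ≤ 31)) :=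
  Finset.map_subset_map.2 (Finset.filter_subset _ _)

/-- The columns of the counterexample are pairwise distinct. -/
theorem cex_cols_injective : Function.Injective
    (fun j : Fin 32 => ((Finset.univ : Finset (Fin 5)).filter
      (fun c : Fin 5 => Nat.testBit (j : ℕ) c.val)).map (Fin.castLEEmb (by norm_num : 5 ≤ 31))) := by
  intro j j' hjj'
  dsimp only at hjj'
  have hsets := Finset.map_injective _ hjj'
  apply Fin.ext
  apply Nat.eq_of_testBit_eq
  intro c
  by_cases hc : c < 5
  · have hmem : ((⟨c, hc⟩ : Fin 5) ∈ (Finset.univ : Finset (Fin 5)).filter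
        (fun c : Fin 5 => Nat.testBit (j : ℕ) c.val)) ↔ ((⟨c, hc⟩ : Fin 5) ∈
        (Finset.univ : Finset (Fin 5)).filter (fun c : Fin 5 => Nat.testBit (j' : ℕ) c.val)) := by
      rw [hsets]
    simp only [Finset.mem_filter, Finset.mem_univ, true_and] at hmem
    exact Bool.eq_iff_iff.2 hmem
  · have h32 : (32 : ℕ) ≤ 2 ^ c :=
      calc (32 : ℕ) = 2 ^ 5 := by norm_num
        _ ≤ 2 ^ c := Nat.pow_le_pow_right (by norm_num) (by omega)
    rw [Nat.testBit_eq_false_of_lt (lt_of_lt_of_le j.isLt h32),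
      Nat.testBit_eq_false_of_lt (lt_of_lt_of_le j'.isLt h32)]

/-- The cardinality side condition of the counterexample: `|T|² + 1 = 26 < 32`. -/
theorem cex_card : ((Finset.univ : Finset (Fin 5)).map (Fin.castLEEmb (by norm_num : 5 ≤ 31))).card *
    ((Finset.univ : Finset (Fin 5)).map (Fin.castLEEmb (by norm_num : 5 ≤ 31))).card + 1 < 32 := by
  rw [Finset.card_map, Finset.card_univ, Fintype.card_fin]
  norm_num

/-- Abstract form of the refutation: ANY `32` pairwise distinct empty-or-singleton rows in `Fin 31`
against ANY `32` pairwise distinct columns inside the block `{0,…,4}` refute TNS. -/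
theorem not_tns_of_rows_cols (u w : Fin 32 → Finset (Fin 31))
    (hu : ∀ i, u i = ∅ ∨ ∃ a, u i = {a})
    (hw : ∀ j, w j ⊆ (Finset.univ : Finset (Fin 5)).map (Fin.castLEEmb (by norm_num : 5 ≤ 31)))
    (huinj : Function.Injective u) (hwinj : Function.Injective w) :
    ¬ Summit.ValiantsHypothesis.ValiantsHypothesis.Theses.BarrierLever.PrincipalMinorLayoutsNonsingular := by
  intro hTNS
  obtain ⟨K, hK⟩ := hTNS 31 32 u w huinj hwinj
  exact hK (tns_det_eq_zero_of_singleton_rows K _ u w hu hw cex_card)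

/-- **Refutation of TNS** (item `PrincipalMinorLayoutsNonsingular`, stmt-ValiantsHypothesis-19126):
NOT every square principal-minor layout matrix is nonsingular for some `K`. Witness: `h = 31`,
`r = 32`, `u = (∅, {0}, …, {30})`, `w =` the `32` subsets of `{0,…,4}`; for EVERY `K ∈ ℂ^{62×62}`
the `32 × 32` matrix `(det K[u_i ⊔ w̄_j])` has rank `≤ 1 + 5² = 26` (`tns_det_eq_zero_of_singleton_rows`).
The mechanism — rows of size `≤ m` against all `2^k` subsets of a `k`-block span at most
`Σ_{l ≤ m} C(k,l)²` dimensions — kills the universal principal-minor witness `det(1 + diag(x,y)K)`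
on layouts of size up to `2^{h/110}`; item 19717 itself (layout-dependent witnesses) is untouched,
and so are the layout classes with `r ≤ (2h)^c` (tree `partitionMinor_hit_of_card_le`). -/
theorem not_PrincipalMinorLayoutsNonsingular :
    ¬ Summit.ValiantsHypothesis.ValiantsHypothesis.Theses.BarrierLever.PrincipalMinorLayoutsNonsingular :=
  not_tns_of_rows_cols
    (fun i : Fin 32 => if (i : ℕ) = 0 then (∅ : Finset (Fin 31))
      else ({⟨(i : ℕ) - 1, by omega⟩} : Finset (Fin 31)))
    (fun j : Fin 32 => ((Finset.univ : Finset (Fin 5)).filter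
      (fun c : Fin 5 => Nat.testBit (j : ℕ) c.val)).map (Fin.castLEEmb (by norm_num : 5 ≤ 31)))
    cex_rows_spec cex_cols_subset cex_rows_injective cex_cols_injective

end Summit.ValiantsHypothesis.ValiantsHypothesis.Theorems.BarrierLever.TNSRefutation
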